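import Mathlib
import HarnessLib

/-!
# Line `taylor-model` on crux K1b-DR (`ExactWindowRungThree.DerivativeEnclosureCertificateR`,
# stmt-NavierStokesRegularity-23954) — stub S1 `stub_soundness`: the objects of the proof

Definitions-only file (no theorems, no sorry) for the proof of the registered stub
`stub_soundness : TaylorModelSoundness` (skeleton v3 `9391589be9c875b2`, line owner ns-idea-2 g3;
`Theorems/TaylorModelRungThreeDefs.lean`), by the method of majorants (`S1-PROOFPLAN.md`):

* `IsMajorantSystem n Q w b T U` — the hypotheses of S1 bundled as one predicate: positive weights `w`,
  `0 ≤ b`, the field `Q` on `Fin n → ℝ` linear in each argument with the WEIGHTED bilinear bound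
  `|Q u v|_c ≤ b·Nu·Nv·w_c` (`|u| ≤ Nu·w`, `|v| ≤ Nv·w`), and the abstract Taylor / variational jet maps
  `T x k`, `U x v k` obeying the Cauchy-product recursions of `u' = Q(u,u)`;
* `pseries a s` — the vector power series `Σ_k a_k s^k` of a coefficient sequence `a : ℕ → Fin n → ℝ`,
  componentwise (`pseries (T x) s` is the flow, `pseries (U x v) s` its first variation);
* `IsSolOn Q x t ψ` — `ψ` solves `ψ' = Q(ψ,ψ)` on `[0,t]` (one-sided at the ends) with `ψ 0 = x`, the
  literal clause shape of S1;
* `flowSel Q x s` — the GLOBAL FLOW SELECTOR: the value at `s` of a solution on `[0,s]` from `x` when one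
  exists (they all agree, by uniqueness), and the junk value `x` otherwise; S1's `Φ`.

MODEL-lattice bookkeeping only (rung TL-M3 of the NS ladder); nothing here is a statement about the
Navier–Stokes equations, and nothing is asserted.
-/

noncomputable section

-- the sub-problem namespace repeats the summit name by design (D-0017)
set_option linter.dupNamespace false

namespace Summit.NavierStokesRegularity.NavierStokesRegularity.Theorems.TaylorModelMajorant

open scoped BigOperators

/-- **The data of S1** (`TaylorModelSoundness`) as one predicate: positive weights `w`, `0 ≤ b`, `Q`
linear in each argument with the weighted bilinear bound `|Q u v|_c ≤ b·Nu·Nv·w_c` whenever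
`|u| ≤ Nu·w`, `|v| ≤ Nv·w`, and jet maps `T`, `U` obeying the Cauchy-product recursions
`T x 0 = x`, `(k+1) T x (k+1) = Σ_{i≤k} Q (T x i) (T x (k-i))`, `U x v 0 = v`,
`(k+1) U x v (k+1) = Σ_{i≤k} (Q (T x i) (U x v (k-i)) + Q (U x v (k-i)) (T x i))` (componentwise,
verbatim the hypotheses of `TaylorModelSoundness`). [folklore] -/
structure IsMajorantSystem (n : ℕ) (Q : (Fin n → ℝ) → (Fin n → ℝ) → Fin n → ℝ) (w : Fin n → ℝ)
    (b : ℝ) (T : (Fin n → ℝ) → ℕ → Fin n → ℝ) (U : (Fin n → ℝ) → (Fin n → ℝ) → ℕ → Fin n → ℝ) :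
    Prop where
  w_pos : ∀ c, 0 < w c
  b_nonneg : 0 ≤ b
  linear_right : ∀ u, IsLinearMap ℝ (Q u)
  linear_left : ∀ v, IsLinearMap ℝ (fun u => Q u v)
  bound : ∀ (u v : Fin n → ℝ) (Nu Nv : ℝ), 0 ≤ Nu → 0 ≤ Nv → (∀ c, |u c| ≤ Nu * w c) →
    (∀ c, |v c| ≤ Nv * w c) → ∀ c, |Q u v c| ≤ b * Nu * Nv * w c
  T_zero : ∀ x, T x 0 = x
  T_succ : ∀ x (k : ℕ) c, ((k : ℝ) + 1) * T x (k + 1) c =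
    ∑ i ∈ Finset.range (k + 1), Q (T x i) (T x (k - i)) c
  U_zero : ∀ x v, U x v 0 = v
  U_succ : ∀ x v (k : ℕ) c, ((k : ℝ) + 1) * U x v (k + 1) c =
    ∑ i ∈ Finset.range (k + 1), (Q (T x i) (U x v (k - i)) c + Q (U x v (k - i)) (T x i) c)

/-- The vector power series `Σ_k a k · s^k` of a coefficient sequence `a : ℕ → Fin n → ℝ`, taken
componentwise (`tsum`; junk `0` in a component where the series diverges). [folklore] -/
def pseries {n : ℕ} (a : ℕ → Fin n → ℝ) (s : ℝ) : Fin n → ℝ := fun c => ∑' k, a k c * s ^ k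

/-- `ψ` solves `ψ' = Q(ψ,ψ)` on `[0,t]` from `x` (derivative within `[0,t]`, one-sided at the end
points) — the literal solution clause of `TaylorModelSoundness`. [folklore] -/
def IsSolOn {n : ℕ} (Q : (Fin n → ℝ) → (Fin n → ℝ) → Fin n → ℝ) (x : Fin n → ℝ) (t : ℝ)
    (ψ : ℝ → Fin n → ℝ) : Prop :=
  ψ 0 = x ∧ ∀ s ∈ Set.Icc 0 t, HasDerivWithinAt ψ (Q (ψ s) (ψ s)) (Set.Icc 0 t) s

open Classical in
/-- **The global flow selector** of `u' = Q(u,u)`: `flowSel Q x s` is the value at time `s` of a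
solution on `[0,s]` starting at `x` if there is one (all such solutions agree when `Q` is locally
Lipschitz), and the junk value `x` otherwise (in particular `flowSel Q x 0 = x`). [folklore] -/
def flowSel {n : ℕ} (Q : (Fin n → ℝ) → (Fin n → ℝ) → Fin n → ℝ) (x : Fin n → ℝ) (s : ℝ) :
    Fin n → ℝ :=
  if h : ∃ ψ, IsSolOn Q x s ψ then h.choose s else x

end Summit.NavierStokesRegularity.NavierStokesRegularity.Theorems.TaylorModelMajorant

end
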